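import Summits.QuantumFields.YangMills.Theorems.BalabanUVNodesN19LawSummabilityThreshold
import Summits.QuantumFields.YangMills.Theorems.BalabanUVNodesN19TargetNotLawSummableSharp
import Mathlib.Analysis.SpecialFunctions.Stirling

/-!
# YM-DAG node N19 (= NE7 proper) — THE LAW-SUMMABILITY THRESHOLD OF THE WINDOW CURRENCY, LOWER HALF, AND THE EXACT THRESHOLD FOR
# ANTITONE REMAINDERS: `Σ_K r(log⁺(vol·δ_K)⁻¹) < ∞ ⟺ every MatchingModConstants-(vol,l₀,δ) sequence of laws has summable increments`

Cell `pub-ymgap`, HUMAN RULING D-0062 (Track A) ∕ D-0149 (work-bound push), R141 (C) wider-strategy seat `pub-ymgap-dag-n19-e` (strategy s3 =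
ALTERNATIVE CURRENCY), generation g22, module 2 (lineage module 75).  Route `Summits/QuantumFields/YangMills/Theses/BalabanUVNodes.lean` rev 25,
cluster item K3⁷ «SpineGivenEndpointR13SepCoPH» (stmt-QuantumFields-20544); filed `--supports` that item `--as helper` (it proves no registered
stub).  COUNT-NEUTRAL: [folklore] over Mathlib (`Stirling.le_log_factorial_stirling`, `Nat.find`, `Summable.even_add_odd`) + the lineage BY NAME —
module 74 `…N19LawSummabilityThreshold` (rate function, upper half), module 72 `exists_chebyshevArc_laws`, module 73 `pow_div_factorial_le_exp_mul_pow`,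
module 64 `abs_log_sub_log_le_of_exp_neg_le` ∕ `exp_neg_le_mgf_id_of_Icc_symm`, p553677 `logRate_le_six_div`; `MatchingModConstants` ∕ `Spine.NE7.Target`
(N19's DECL-target SHAPE) are CONCLUDED for explicit TOY families `Z_K = mgf λ_K`; no scheme object, no Theses import; NOT a discharge claim.

THE ANSWER, LOWER HALF ★★ `exists_matchingModConstants_not_summable_lawIncrements`: for EVERY window `l₀ > 0`, `vol > 0` and EVERY ANTITONE
`δ > 0` with `Σ_K r(log⁺(vol·δ_K)⁻¹) = ∞` (`r(L) = log(e+L)∕(1+L)`) there are probability laws `λ_K` on `[−1,1]` with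
`MatchingModConstants vol l₀ δ (K t ↦ mgf λ_K t)` (constants `0`) and continuous tests `g_K`, `1`-Lipschitz and `1`-bounded on `[−1,1]`, whose increments
`|∫g_K dλ_{K+1} − ∫g_K dλ_K|` are NOT summable.  THE SEQUENCE: module 72's complementary Chebyshev-arc laws at THE LEVEL OF THE BUDGET —
`λ_{2i} = P_{n_i}`, `λ_{2i+1} = Q_{n_i}`, `n_i = N + J_i`, `N = max(3, ⌈2l₀⌉)`, `J_i` the LEAST `j` with step cost `4e^{l₀}·l₀^{N+j−1}∕(N+j−1)! ≤ vol·δ_{2i+1}`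
(`Nat.find`; it exists since the cost is super-geometric, module 73).  Because `δ` is antitone the levels are non-decreasing, so (module 73's pattern) the
same-level step `P_{n_i} → Q_{n_i}` costs `≤ 4b` and the cross step `Q_{n_i} → P_{n_{i+1}}` costs `≤ 2b_{n_i} + 2b_{n_{i+1}} ≤ 4b_{n_i}` in mgf through the
ONE base `½∫_{−1}^{1}e^{tx}`, hence `≤ vol·δ_{2i+1} ≤ vol·δ_{2i}` in cgf (`log` is `e^{l₀}`-Lipschitz above `e^{−l₀}`); the even steps are paid EXACTLY
`1∕(2n_i)`.  THE INVERSION LEMMA ★ `logRate_le_div_of_lt_stepCost`: minimality of `J_i` says `vol·δ_{2i+1} < 4e^{l₀}l₀^k∕k!` with `k = n_i − 2`, and for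
`k` past the explicit threshold `K₀(l₀) = max(⌈8l₀+12⌉, ⌈e^{2(1+log l₀)}⌉)` Stirling's `log k! ≥ k log k − k` gives `log⁺x⁻¹ ≥ (k∕4)log k ≥ (k∕4)log(k∕2)`,
whence (`r` antitone, p553677 `logRate_le_six_div` at `n = k∕2`) `r(log⁺(vol·δ_{2i+1})⁻¹) ≤ 12∕k ≤ 36∕n_i`; small levels are bounded outright.  So
`κ(l₀)·r_{2i+1} ≤ 1∕(2n_i)` for all `i`; summable increments would make `Σ_i r_{2i+1}`, then (antitone) `Σ_i r_{2i+2}`, then `Σ_K r_K` finite — contradiction.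
COROLLARIES: ★ `exists_target_not_summable_lawIncrements` (with `Σδ < ∞` the family meets `Spine.NE7.Target vol l₀ δ` itself); ★★
`summable_lawIncrements_iff_summable_logRate` — FOR ANTITONE REMAINDERS THE THRESHOLD IS EXACT: `Σ_K r(log⁺(vol·δ_K)⁻¹) < ∞` IFF every
MatchingModConstants-`(vol,l₀,δ)` sequence of probability laws on `[−1,1]` has summable bounded-Lipschitz increments along every test sequence
continuous, `1`-Lipschitz and `1`-bounded on `[−1,1]` (⇒ is module 74).  READING: `r(log⁺ε⁻¹) ≍ log log ε⁻¹ ∕ log ε⁻¹`; geometric `δ_K = Cθ^K` gives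
`r ≍ log K∕K` (divergent: N19's `Target` with the programme's remainders does NOT control the string laws summably — module 76 types this instance),
`δ_K = e^{−K²}` gives `r ≍ log K∕K²` (convergent).  HONEST LIMIT: for NON-monotone `δ` the divergence of `Σ r` is NOT claimed sufficient (isolated large
budgets between tiny ones interact); not needed by any consumer and left open.

HONEST FRAMING (binding).  Elementary and [folklore]; TOY families; NO consumer in the DAG today (a structural statement about the seat's own
currencies); nothing of Bałaban's instantiated; NE7 NOT PRINTED, NOT proved; N19 NOT discharged; count-neutral.  One finite `T⁴` programme at fixed
`ε`; nothing continuum ∕ `ℝ⁴` ∕ OS ∕ mass-gap ∕ Clay.  0 `def` ∕ 0 `sorry`.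
-/

noncomputable section

open Real Filter Topology MeasureTheory ProbabilityTheory

namespace Summit.QuantumFields.YangMills.Theorems.BalabanUVNodesN19LawSummabilityThresholdSharp

open Literature.MathematicalPhysics.QuantumFieldTheory.Balaban1983to89
open T4CauchySum (MatchingModConstants)
open Summit.QuantumFields.BalabanUV.T4Continuum.Spine
open Summit.QuantumFields.YangMills.Theorems.BalabanUVNodesN19LawIncrementsTarget (abs_log_sub_log_le_of_exp_neg_le exp_neg_le_mgf_id_of_Icc_symm)
open Summit.QuantumFields.YangMills.Theorems.BalabanUVNodesN19ChebyshevArcLaws (exists_chebyshevArc_laws)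
open Summit.QuantumFields.YangMills.Theorems.BalabanUVNodesN19TargetNotLawSummableSharp (pow_div_factorial_le_exp_mul_pow)
open Summit.QuantumFields.YangMills.Theorems.BalabanUVNodesN19LawPriceLowerRate (logRate_le_six_div)
open Summit.QuantumFields.YangMills.Theorems.BalabanUVNodesN19LawSummabilityThreshold
  (logRate_antitone logRate_le_one logRate_pos logRate_posLog_inv_mono summable_lawIncrements_of_matchingModConstants)

/-! ## §1 The inversion lemma: a budget below the step cost of exponent `k` has rate `≤ 12∕k` [folklore] -/

/-- Stirling from below in the crude form used here: `k·log k − k ≤ log k!` (`k ≥ 1`; Mathlib's `Stirling.le_log_factorial_stirling`). [folklore] -/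
theorem mul_log_sub_le_log_factorial {k : ℕ} (hk : 1 ≤ k) : (k : ℝ) * Real.log k - k ≤ Real.log (k.factorial : ℝ) := by
  have h := Stirling.le_log_factorial_stirling (n := k) (by omega)
  have h1 : 0 ≤ Real.log k := Real.log_nonneg (by exact_mod_cast hk)
  have h2 : 0 ≤ Real.log (2 * π) := Real.log_nonneg (by linarith [Real.pi_gt_three])
  linarith

/-- ★ **THE INVERSION LEMMA.**  If `0 < x < 4e^{l₀}·l₀^k∕k!` with `k ≥ 4`, `log k ≥ 2(1 + log l₀)` and `k ≥ 8l₀ + 12`, then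
`r(log⁺x⁻¹) ≤ 12∕k`: by Stirling `log⁺x⁻¹ ≥ k log k − k − k log l₀ − l₀ − log 4 ≥ (k∕4)log k ≥ (k∕4)log(k∕2)`, and `r` is antitone with
`r((k∕4)log(k∕2)) ≤ 6∕(k∕2)` (p553677 `logRate_le_six_div` at `n = k∕2`, `e + (k∕4)log(k∕2) ≤ (k∕2)³`). [folklore] -/
theorem logRate_le_div_of_lt_stepCost {l₀ x : ℝ} (hl₀ : 0 < l₀) (hx : 0 < x) {k : ℕ} (hk4 : 4 ≤ k)
    (hka : 2 * (1 + Real.log l₀) ≤ Real.log k) (hkb : 8 * l₀ + 12 ≤ (k : ℝ))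
    (hlt : x < 4 * Real.exp l₀ * (l₀ ^ k / (k.factorial : ℝ))) :
    Real.log (Real.exp 1 + Real.posLog x⁻¹) / (1 + Real.posLog x⁻¹) ≤ 12 / k := by
  have hkr : (4 : ℝ) ≤ k := by exact_mod_cast hk4
  have hk0 : (0 : ℝ) < k := by linarith
  have hlogk : 0 ≤ Real.log k := Real.log_nonneg (by linarith)
  have hlogk1 : 1 ≤ Real.log k := by
    calc (1 : ℝ) = Real.log (Real.exp 1) := (Real.log_exp 1).symm
      _ ≤ Real.log k := Real.log_le_log (Real.exp_pos 1) (by linarith [Real.exp_one_lt_d9])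
  have hfac : (0 : ℝ) < k.factorial := by exact_mod_cast k.factorial_pos
  -- `L := log⁺x⁻¹ ≥ −log x > −log(4e^{l₀}l₀^k∕k!)`
  set L : ℝ := Real.posLog x⁻¹ with hLdef
  have hLlog : -Real.log x ≤ L := by
    rw [hLdef, Real.posLog_apply, ← Real.log_inv]
    exact le_max_right _ _
  have hlogx : Real.log x < Real.log (4 * Real.exp l₀ * (l₀ ^ k / (k.factorial : ℝ))) := Real.log_lt_log hx hlt
  have hlogC : Real.log (4 * Real.exp l₀ * (l₀ ^ k / (k.factorial : ℝ))) =
      Real.log 4 + l₀ + k * Real.log l₀ - Real.log (k.factorial : ℝ) := by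
    rw [Real.log_mul (by positivity) (by positivity), Real.log_mul (by norm_num) (Real.exp_pos _).ne', Real.log_exp,
      Real.log_div (by positivity) hfac.ne', Real.log_pow]
    ring
  have hst := mul_log_sub_le_log_factorial (k := k) (by omega)
  have hlog4 : Real.log 4 ≤ 3 / 2 := by
    have e : Real.log 4 = 2 * Real.log 2 := by
      rw [show (4 : ℝ) = 2 ^ 2 by norm_num, Real.log_pow]; norm_num
    rw [e]; linarith [Real.log_two_lt_d9]
  -- so `L ≥ k log k − k − k log l₀ − l₀ − log 4 ≥ (k∕4) log k ≥ (k∕4) log(k∕2)`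
  have hL1 : (k : ℝ) * Real.log k - k - k * Real.log l₀ - l₀ - Real.log 4 ≤ L := by linarith
  have ha' : (k : ℝ) * (1 + Real.log l₀) ≤ k / 2 * Real.log k := by nlinarith
  have hb' : l₀ + Real.log 4 ≤ k / 8 * Real.log k := by nlinarith
  have hL2 : (k : ℝ) / 4 * Real.log k ≤ L := by nlinarith
  have hlogk2 : Real.log (k / 2) ≤ Real.log k := Real.log_le_log (by linarith) (by linarith)
  have hlogk2' : 0 ≤ Real.log ((k : ℝ) / 2) := Real.log_nonneg (by linarith)
  have hL' : (k : ℝ) / 4 * Real.log (k / 2) ≤ L := (mul_le_mul_of_nonneg_left hlogk2 (by positivity)).trans hL2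
  have hL'0 : 0 ≤ (k : ℝ) / 4 * Real.log (k / 2) := by positivity
  -- `e + (k∕4)log(k∕2) ≤ (k∕2)³`
  have hL3 : Real.exp 1 + (k : ℝ) / 4 * Real.log (k / 2) ≤ ((k : ℝ) / 2) ^ 3 := by
    have hlk : Real.log ((k : ℝ) / 2) ≤ k / 2 - 1 := Real.log_le_sub_one_of_pos (by linarith)
    have he : Real.exp 1 < 2.7182818286 := Real.exp_one_lt_d9
    nlinarith [mul_le_mul_of_nonneg_left hlk (by linarith : (0 : ℝ) ≤ k / 4), mul_nonneg (sub_nonneg.2 hkr) (sq_nonneg (k : ℝ))]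
  have h6 := logRate_le_six_div (n := (k : ℝ) / 2) (L := (k : ℝ) / 4 * Real.log (k / 2)) (by linarith) (le_of_eq (by ring)) hL3
  calc Real.log (Real.exp 1 + L) / (1 + L)
      ≤ Real.log (Real.exp 1 + (k : ℝ) / 4 * Real.log (k / 2)) / (1 + (k : ℝ) / 4 * Real.log (k / 2)) := logRate_antitone hL'0 hL'
    _ ≤ 6 / ((k : ℝ) / 2) := h6
    _ = 12 / k := by
        field_simp
        ring

/-! ## §2 The Chebyshev-arc sequence at the level of the budget [folklore] -/

/-- ★★ **THE LOWER HALF OF THE THRESHOLD.**  For every `l₀ > 0`, `vol > 0` and every ANTITONE `δ > 0` whose rates `r(log⁺(vol·δ_K)⁻¹)`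
(`r(L) = log(e+L)∕(1+L)`) are NOT summable, there are probability laws `λ_K` on `[−1,1]` with `MatchingModConstants vol l₀ δ (K t ↦ mgf λ_K t)`
(matching modulo the constants `0`) and continuous test functions `g_K`, `1`-Lipschitz and `1`-bounded on `[−1,1]`, whose bounded-Lipschitz increments
`|∫g_K dλ_{K+1} − ∫g_K dλ_K|` are NOT summable (the Chebyshev-arc sequence at the level of the budget, header). [folklore] -/
theorem exists_matchingModConstants_not_summable_lawIncrements {l₀ vol : ℝ} (hl₀ : 0 < l₀) (hvol : 0 < vol) {δ : ℕ → ℝ}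
    (hδ : ∀ K, 0 < δ K) (hanti : Antitone δ)
    (hS : ¬ Summable fun K => Real.log (Real.exp 1 + Real.posLog (vol * δ K)⁻¹) / (1 + Real.posLog (vol * δ K)⁻¹)) :
    ∃ Λ : ℕ → Measure ℝ, (∀ K, IsProbabilityMeasure (Λ K)) ∧ (∀ K, Λ K (Set.Icc (-1 : ℝ) 1)ᶜ = 0) ∧
      MatchingModConstants vol l₀ δ (fun K t => mgf id (Λ K) t) ∧
      ∃ g : ℕ → ℝ → ℝ, (∀ K, Continuous (g K)) ∧
        (∀ (K : ℕ) (x y : ℝ), x ∈ Set.Icc (-1 : ℝ) 1 → y ∈ Set.Icc (-1 : ℝ) 1 → |g K x - g K y| ≤ 1 * |x - y|) ∧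
        (∀ (K : ℕ) (x : ℝ), x ∈ Set.Icc (-1 : ℝ) 1 → |g K x| ≤ 1) ∧
        ¬ Summable (fun K => |∫ x, g K x ∂Λ (K + 1) - ∫ x, g K x ∂Λ K|) := by
  classical
  -- the base level `N = max(3, ⌈2l₀⌉)`
  set N : ℕ := max 3 ⌈2 * l₀⌉₊ with hNdef
  have hN3 : 3 ≤ N := le_max_left _ _
  have hNl : 2 * l₀ ≤ N := (Nat.le_ceil _).trans (by exact_mod_cast le_max_right 3 ⌈2 * l₀⌉₊)
  -- the arc laws at the levels `N + j`
  choose P Q iP iQ hPc hQc hmgf g hgc hgL hgB hpay using fun j : ℕ => exists_chebyshevArc_laws (n := N + j) (by omega)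
  haveI : ∀ j, IsProbabilityMeasure (P j) := iP
  haveI : ∀ j, IsProbabilityMeasure (Q j) := iQ
  -- the window remainder `b j = l₀^{N+j−1}∕(N+j−1)!`, antitone in `j`
  set b : ℕ → ℝ := fun j => l₀ ^ (N + j - 1) / ((N + j - 1).factorial : ℝ) with hbdef
  have hb0 : ∀ j, 0 ≤ b j := fun j => by positivity
  have hb_anti : ∀ j, b (j + 1) ≤ b j := fun j => by
    simp only [hbdef]
    have e : N + (j + 1) - 1 = (N + j - 1) + 1 := by omega
    rw [e, pow_succ, Nat.factorial_succ, Nat.cast_mul, div_le_div_iff₀ (by positivity) (by positivity)]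
    have hlN : l₀ ≤ ((N + j - 1 : ℕ) : ℝ) + 1 := by
      have : ((N + j - 1 : ℕ) : ℝ) + 1 = (N : ℝ) + j := by rw [Nat.cast_sub (R := ℝ) (by omega)]; push_cast; ring
      rw [this]; linarith [(Nat.cast_nonneg j : (0 : ℝ) ≤ j)]
    have hf : (0 : ℝ) < (N + j - 1).factorial := by positivity
    have hp : (0 : ℝ) ≤ l₀ ^ (N + j - 1) := by positivity
    push_cast
    nlinarith [mul_le_mul_of_nonneg_left hlN (mul_nonneg hp hf.le)]
  have hb_mono : ∀ {i j : ℕ}, i ≤ j → b j ≤ b i := fun {i j} hij => (antitone_nat_of_succ_le hb_anti) hij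
  -- the step cost `4e^{l₀}·b j` is eventually below every positive budget (super-geometric, module 73)
  have hcost_small : ∀ x : ℝ, 0 < x → ∃ j : ℕ, 4 * Real.exp l₀ * b j ≤ x := by
    intro x hx
    set C : ℝ := 4 * Real.exp l₀ * Real.exp (l₀ / (1 / 2) ^ 2) with hC
    have hC0 : 0 < C := by positivity
    obtain ⟨n, hn⟩ := exists_pow_lt_of_lt_one (div_pos hx hC0) (by norm_num : (1 / 2 : ℝ) < 1)
    refine ⟨n, ?_⟩
    have h := pow_div_factorial_le_exp_mul_pow hl₀.le (by norm_num : (0 : ℝ) < 1 / 2) (N + n - 1)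
    have hK : n ≤ 2 * (N + n - 1) := by omega
    have hpow : (1 / 2 : ℝ) ^ (2 * (N + n - 1)) ≤ (1 / 2 : ℝ) ^ n := pow_le_pow_of_le_one (by norm_num) (by norm_num) hK
    calc 4 * Real.exp l₀ * b n ≤ 4 * Real.exp l₀ * (Real.exp (l₀ / (1 / 2) ^ 2) * (1 / 2 : ℝ) ^ n) :=
          mul_le_mul_of_nonneg_left (h.trans (mul_le_mul_of_nonneg_left hpow (by positivity))) (by positivity)
      _ = C * (1 / 2 : ℝ) ^ n := by rw [hC]; ring
      _ ≤ C * (x / C) := mul_le_mul_of_nonneg_left hn.le hC0.le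
      _ = x := by field_simp
  -- THE LEVEL OF THE BUDGET at the odd steps: `J i` = the least `j` whose step cost fits `vol·δ_{2i+1}`
  have hex : ∀ i : ℕ, ∃ j : ℕ, 4 * Real.exp l₀ * b j ≤ vol * δ (2 * i + 1) := fun i => hcost_small _ (mul_pos hvol (hδ _))
  let J : ℕ → ℕ := fun i => Nat.find (hex i)
  have hJspec : ∀ i, 4 * Real.exp l₀ * b (J i) ≤ vol * δ (2 * i + 1) := fun i => Nat.find_spec (hex i)
  have hJmin : ∀ i j, j < J i → vol * δ (2 * i + 1) < 4 * Real.exp l₀ * b j := fun i j hj =>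
    not_le.1 (Nat.find_min (hex i) hj)
  have hJmono : ∀ i, J i ≤ J (i + 1) := fun i =>
    Nat.find_min' (hex i) ((hJspec (i + 1)).trans (mul_le_mul_of_nonneg_left (hanti (by omega)) hvol.le))
  -- every step costs `≤ 4 b` in mgf on the window: same level `P_j ↔ Q_j`, or up the levels `Q_i → P_j` (`i ≤ j`)
  have hmgfPQ : ∀ (j : ℕ) (t : ℝ), |t| ≤ l₀ → |mgf id (Q j) t - mgf id (P j) t| ≤ 4 * b j := fun j t ht => by
    obtain ⟨h1, h2⟩ := hmgf j l₀ t (by push_cast; linarith) ht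
    calc |mgf id (Q j) t - mgf id (P j) t|
        ≤ |mgf id (Q j) t - 1 / 2 * ∫ x in (-1 : ℝ)..1, Real.exp (t * x)| +
          |1 / 2 * (∫ x in (-1 : ℝ)..1, Real.exp (t * x)) - mgf id (P j) t| := abs_sub_le _ _ _
      _ = |mgf id (Q j) t - 1 / 2 * ∫ x in (-1 : ℝ)..1, Real.exp (t * x)| +
          |mgf id (P j) t - 1 / 2 * ∫ x in (-1 : ℝ)..1, Real.exp (t * x)| := by rw [abs_sub_comm (1 / 2 * _) (mgf id (P j) t)]
      _ ≤ 2 * b j + 2 * b j := add_le_add h2 h1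
      _ = 4 * b j := by ring
  have hmgfQP : ∀ (i j : ℕ) (t : ℝ), i ≤ j → |t| ≤ l₀ → |mgf id (P j) t - mgf id (Q i) t| ≤ 4 * b i := fun i j t hij ht => by
    obtain ⟨-, h2⟩ := hmgf i l₀ t (by push_cast; linarith) ht
    obtain ⟨h1, -⟩ := hmgf j l₀ t (by push_cast; linarith) ht
    calc |mgf id (P j) t - mgf id (Q i) t|
        ≤ |mgf id (P j) t - 1 / 2 * ∫ x in (-1 : ℝ)..1, Real.exp (t * x)| +
          |1 / 2 * (∫ x in (-1 : ℝ)..1, Real.exp (t * x)) - mgf id (Q i) t| := abs_sub_le _ _ _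
      _ = |mgf id (P j) t - 1 / 2 * ∫ x in (-1 : ℝ)..1, Real.exp (t * x)| +
          |mgf id (Q i) t - 1 / 2 * ∫ x in (-1 : ℝ)..1, Real.exp (t * x)| := by rw [abs_sub_comm (1 / 2 * _) (mgf id (Q i) t)]
      _ ≤ 2 * b j + 2 * b i := add_le_add h1 h2
      _ ≤ 4 * b i := by linarith [hb_mono hij]
  -- the sequence and the tests
  set Λ : ℕ → Measure ℝ := fun K => if Even K then P (J (K / 2)) else Q (J (K / 2)) with hΛ
  have hΛP : ∀ K, IsProbabilityMeasure (Λ K) := fun K => by simp only [hΛ]; split_ifs <;> infer_instance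
  have hΛc : ∀ K, Λ K (Set.Icc (-1 : ℝ) 1)ᶜ = 0 := fun K => by simp only [hΛ]; split_ifs; exacts [hPc _, hQc _]
  refine ⟨Λ, hΛP, hΛc, fun K => ⟨0, fun t ht => ?_⟩, fun K => g (J (K / 2)), fun K => hgc _, fun K x y hx hy => hgL _ x y hx hy,
    fun K x hx => (hgB _ x hx).trans ?_, fun hSum => ?_⟩
  · -- matching modulo the constants `0`: the cgf increment at step `K` is `≤ 4e^{l₀} b_{J(K∕2)} ≤ vol·δ_K`
    rw [sub_zero]
    change |cgf id (Λ (K + 1)) t - cgf id (Λ K) t| ≤ vol * δ K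
    have hlow : ∀ K, Real.exp (-l₀) ≤ mgf id (Λ K) t := fun K => by
      haveI := hΛP K
      exact exp_neg_le_mgf_id_of_Icc_symm (Λ K) (hΛc K) ht
    have hm : |mgf id (Λ (K + 1)) t - mgf id (Λ K) t| ≤ 4 * b (J (K / 2)) := by
      rcases Nat.even_or_odd K with ⟨i, rfl⟩ | ⟨i, rfl⟩
      · have h1 : ¬Even (i + i + 1) := by rw [Nat.not_even_iff_odd]; exact ⟨i, by ring⟩
        have e1 : (i + i) / 2 = i := by omega
        have e2 : (i + i + 1) / 2 = i := by omega
        simp only [hΛ, Even.add_self i, if_true, h1, if_false, e1, e2]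
        exact hmgfPQ (J i) t ht
      · have h0 : ¬Even (2 * i + 1) := Nat.not_even_iff_odd.2 ⟨i, rfl⟩
        have h1 : Even (2 * i + 1 + 1) := ⟨i + 1, by ring⟩
        have e1 : (2 * i + 1) / 2 = i := by omega
        have e2 : (2 * i + 1 + 1) / 2 = i + 1 := by omega
        simp only [hΛ, h0, if_false, h1, if_true, e1, e2]
        exact hmgfQP (J i) (J (i + 1)) t (hJmono i) ht
    have hbud : 4 * Real.exp l₀ * b (J (K / 2)) ≤ vol * δ K := by
      rcases Nat.even_or_odd K with ⟨i, rfl⟩ | ⟨i, rfl⟩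
      · have e1 : (i + i) / 2 = i := by omega
        rw [e1]
        exact (hJspec i).trans (mul_le_mul_of_nonneg_left (hanti (by omega)) hvol.le)
      · have e1 : (2 * i + 1) / 2 = i := by omega
        rw [e1]
        exact hJspec i
    calc |cgf id (Λ (K + 1)) t - cgf id (Λ K) t| = |Real.log (mgf id (Λ (K + 1)) t) - Real.log (mgf id (Λ K) t)| := by rw [cgf, cgf]
      _ ≤ Real.exp l₀ * |mgf id (Λ (K + 1)) t - mgf id (Λ K) t| := abs_log_sub_log_le_of_exp_neg_le (hlow _) (hlow _)
      _ ≤ Real.exp l₀ * (4 * b (J (K / 2))) := mul_le_mul_of_nonneg_left hm (Real.exp_pos _).le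
      _ = 4 * Real.exp l₀ * b (J (K / 2)) := by ring
      _ ≤ vol * δ K := hbud
  · -- `1∕(2(N + J)) ≤ 1`
    rw [div_le_one (by positivity)]
    have : (1 : ℝ) ≤ ((N + J (K / 2) : ℕ) : ℝ) := by exact_mod_cast (by omega : 1 ≤ N + J (K / 2))
    linarith
  · -- NOT SUMMABLE.  The even steps pay exactly `1∕(2(N + J i))`.
    have h2 : Summable (fun i : ℕ => |∫ x, g (J ((2 * i) / 2)) x ∂Λ (2 * i + 1) - ∫ x, g (J ((2 * i) / 2)) x ∂Λ (2 * i)|) :=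
      hSum.comp_injective (fun a c h => by simpa using h : Function.Injective fun i : ℕ => 2 * i)
    have h3 : ∀ i : ℕ, |∫ x, g (J ((2 * i) / 2)) x ∂Λ (2 * i + 1) - ∫ x, g (J ((2 * i) / 2)) x ∂Λ (2 * i)| =
        1 / (2 * ((N + J i : ℕ) : ℝ)) := by
      intro i
      have h0 : ¬Even (2 * i + 1) := Nat.not_even_iff_odd.2 ⟨i, rfl⟩
      have e1 : 2 * i / 2 = i := by omega
      have e2 : (2 * i + 1) / 2 = i := by omega
      simp only [hΛ, even_two_mul, if_true, h0, if_false, e1, e2]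
      rw [abs_sub_comm, hpay (J i), abs_of_pos (by positivity)]
    simp_rw [h3] at h2
    -- the rates, antitone in `K`
    set r : ℕ → ℝ := fun K => Real.log (Real.exp 1 + Real.posLog (vol * δ K)⁻¹) / (1 + Real.posLog (vol * δ K)⁻¹) with hrdef
    have hr0 : ∀ K, 0 ≤ r K := fun K => (logRate_pos Real.posLog_nonneg).le
    have hr1 : ∀ K, r K ≤ 1 := fun K => logRate_le_one Real.posLog_nonneg
    have hr_anti : ∀ {K K' : ℕ}, K ≤ K' → r K' ≤ r K := fun {K K'} h =>
      logRate_posLog_inv_mono (mul_pos hvol (hδ K')) (mul_le_mul_of_nonneg_left (hanti h) hvol.le)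
    -- THE INVERSION: `κ·r_{2i+1} ≤ 1∕(2(N + J i))` with the explicit threshold `K₀(l₀)`
    set K₀ : ℕ := max ⌈8 * l₀ + 12⌉₊ ⌈Real.exp (2 * (1 + Real.log l₀))⌉₊ with hK₀
    set κ : ℝ := 1 / (72 + 2 * ((N : ℝ) + K₀ + 2)) with hκ
    have hκ0 : 0 < κ := by positivity
    have hκ72 : κ ≤ 1 / 72 :=
      one_div_le_one_div_of_le (by norm_num) (by linarith [show (0 : ℝ) ≤ 2 * ((N : ℝ) + K₀ + 2) by positivity])
    have hkey : ∀ i : ℕ, κ * r (2 * i + 1) ≤ 1 / (2 * ((N + J i : ℕ) : ℝ)) := by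
      intro i
      have hnpos : (0 : ℝ) < ((N + J i : ℕ) : ℝ) := by exact_mod_cast (by omega : 0 < N + J i)
      by_cases hsmall : N + J i ≤ N + K₀ + 2
      · -- small level: `κ·r ≤ κ ≤ 1∕(2(N + K₀ + 2)) ≤ 1∕(2(N + J i))`
        have h1 : κ * r (2 * i + 1) ≤ κ := mul_le_of_le_one_right hκ0.le (hr1 _)
        have hle : ((N + J i : ℕ) : ℝ) ≤ (N : ℝ) + K₀ + 2 := by exact_mod_cast hsmall
        have h4 : κ ≤ 1 / (2 * ((N + J i : ℕ) : ℝ)) := one_div_le_one_div_of_le (by positivity) (by linarith)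
        exact h1.trans h4
      · -- large level: minimality of `J i` at `j = J i − 1`, exponent `k = N + J i − 2 ≥ K₀`
        rw [not_le] at hsmall
        have hlt := hJmin i (J i - 1) (by omega)
        set k : ℕ := N + (J i - 1) - 1 with hkdef
        have hkK₀ : K₀ ≤ k := by omega
        have hk_ge1 : (⌈8 * l₀ + 12⌉₊ : ℝ) ≤ k := by exact_mod_cast (le_max_left _ _).trans hkK₀
        have hk_ge2 : (⌈Real.exp (2 * (1 + Real.log l₀))⌉₊ : ℝ) ≤ k := by exact_mod_cast (le_max_right _ _).trans hkK₀
        have hkb : 8 * l₀ + 12 ≤ (k : ℝ) := (Nat.le_ceil _).trans hk_ge1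
        have hk4 : 4 ≤ k := by
          have : (4 : ℝ) ≤ k := by linarith
          exact_mod_cast this
        have hkpos : (0 : ℝ) < k := by linarith
        have hka : 2 * (1 + Real.log l₀) ≤ Real.log k := by
          rw [Real.le_log_iff_exp_le hkpos]
          exact (Nat.le_ceil _).trans hk_ge2
        have hb_eq : b (J i - 1) = l₀ ^ k / (k.factorial : ℝ) := by simp only [hbdef, hkdef]
        rw [hb_eq] at hlt
        have hrate : r (2 * i + 1) ≤ 12 / k := logRate_le_div_of_lt_stepCost hl₀ (mul_pos hvol (hδ _)) hk4 hka hkb hlt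
        have hk3 : ((N + J i : ℕ) : ℝ) ≤ 3 * k := by exact_mod_cast (by omega : N + J i ≤ 3 * k)
        calc κ * r (2 * i + 1) ≤ (1 / 72) * (12 / k) := mul_le_mul hκ72 hrate (hr0 _) (by norm_num)
          _ = 1 / (6 * k) := by
              field_simp
              ring
          _ ≤ 1 / (2 * ((N + J i : ℕ) : ℝ)) := one_div_le_one_div_of_le (by positivity) (by linarith)
    -- summability transfer: odd rates, then even rates, then all rates — contradiction
    have hodd : Summable (fun i : ℕ => r (2 * i + 1)) :=
      Summable.of_nonneg_of_le (fun i => hr0 _) (fun i => (le_div_iff₀' hκ0).2 (hkey i)) (h2.div_const κ)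
    have heven : Summable (fun i : ℕ => r (2 * i)) := by
      have h1 : Summable (fun i : ℕ => r (2 * (i + 1))) :=
        Summable.of_nonneg_of_le (fun i => hr0 _) (fun i => hr_anti (by omega)) hodd
      exact (summable_nat_add_iff 1).1 h1
    exact hS (Summable.even_add_odd heven hodd)

/-- ★ **IN N19's DECL-TARGET SHAPE.**  If moreover `Σδ < ∞`, the family of `exists_matchingModConstants_not_summable_lawIncrements` satisfies
`Spine.NE7.Target vol l₀ δ (K t ↦ mgf λ_K t)` itself: N19's DECL target with a summable antitone remainder whose rates diverge (e.g. every geometric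
`Cθ^K`) does NOT control the bounded-Lipschitz increments of the laws summably. [folklore] -/
theorem exists_target_not_summable_lawIncrements {l₀ vol : ℝ} (hl₀ : 0 < l₀) (hvol : 0 < vol) {δ : ℕ → ℝ}
    (hδ : ∀ K, 0 < δ K) (hanti : Antitone δ) (hsum : Summable δ)
    (hS : ¬ Summable fun K => Real.log (Real.exp 1 + Real.posLog (vol * δ K)⁻¹) / (1 + Real.posLog (vol * δ K)⁻¹)) :
    ∃ Λ : ℕ → Measure ℝ, (∀ K, IsProbabilityMeasure (Λ K)) ∧ (∀ K, Λ K (Set.Icc (-1 : ℝ) 1)ᶜ = 0) ∧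
      NE7.Target vol l₀ δ (fun K t => mgf id (Λ K) t) ∧
      ∃ g : ℕ → ℝ → ℝ, (∀ K, Continuous (g K)) ∧
        (∀ (K : ℕ) (x y : ℝ), x ∈ Set.Icc (-1 : ℝ) 1 → y ∈ Set.Icc (-1 : ℝ) 1 → |g K x - g K y| ≤ 1 * |x - y|) ∧
        (∀ (K : ℕ) (x : ℝ), x ∈ Set.Icc (-1 : ℝ) 1 → |g K x| ≤ 1) ∧
        ¬ Summable (fun K => |∫ x, g K x ∂Λ (K + 1) - ∫ x, g K x ∂Λ K|) := by
  obtain ⟨Λ, hP, hc, hM, g, hg⟩ := exists_matchingModConstants_not_summable_lawIncrements hl₀ hvol hδ hanti hS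
  exact ⟨Λ, hP, hc, ⟨hM, hsum⟩, g, hg⟩

/-! ## §3 The exact threshold for antitone remainders [folklore] -/

/-- ★★ **THE EXACT LAW-SUMMABILITY THRESHOLD OF THE WINDOW CURRENCY (antitone remainders).**  For `l₀ > 0`, `vol > 0` and an antitone `δ > 0`:
`Σ_K r(log⁺(vol·δ_K)⁻¹) < ∞` (`r(L) = log(e+L)∕(1+L)`) IF AND ONLY IF every sequence of probability laws `λ_K` on `[−1,1]` with
`MatchingModConstants vol l₀ δ (K t ↦ mgf λ_K t)` has summable increments `|∫g_K dλ_{K+1} − ∫g_K dλ_K|` along every sequence of continuous tests `g_K`,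
`1`-Lipschitz and `1`-bounded on `[−1,1]`.  (⇒ module 74 `summable_lawIncrements_of_matchingModConstants`; ⇐ §2.) [folklore] -/
theorem summable_lawIncrements_iff_summable_logRate {l₀ vol : ℝ} (hl₀ : 0 < l₀) (hvol : 0 < vol) {δ : ℕ → ℝ}
    (hδ : ∀ K, 0 < δ K) (hanti : Antitone δ) :
    (Summable fun K => Real.log (Real.exp 1 + Real.posLog (vol * δ K)⁻¹) / (1 + Real.posLog (vol * δ K)⁻¹)) ↔
      ∀ Λ : ℕ → Measure ℝ, (∀ K, IsProbabilityMeasure (Λ K)) → (∀ K, Λ K (Set.Icc (-1 : ℝ) 1)ᶜ = 0) →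
        MatchingModConstants vol l₀ δ (fun K t => mgf id (Λ K) t) →
        ∀ g : ℕ → ℝ → ℝ, (∀ K, Continuous (g K)) →
          (∀ (K : ℕ) (x y : ℝ), x ∈ Set.Icc (-1 : ℝ) 1 → y ∈ Set.Icc (-1 : ℝ) 1 → |g K x - g K y| ≤ 1 * |x - y|) →
          (∀ (K : ℕ) (x : ℝ), x ∈ Set.Icc (-1 : ℝ) 1 → |g K x| ≤ 1) →
          Summable fun K => |∫ x, g K x ∂Λ (K + 1) - ∫ x, g K x ∂Λ K| := by
  refine ⟨fun hS Λ hP hc hM g _ hL hB => ?_, fun h => ?_⟩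
  · haveI := hP
    exact summable_lawIncrements_of_matchingModConstants hc hl₀ hM hS zero_le_one hL hB
  · by_contra hS
    obtain ⟨Λ, hP, hc, hM, g, hgc, hL, hB, hns⟩ := exists_matchingModConstants_not_summable_lawIncrements hl₀ hvol hδ hanti hS
    exact hns (h Λ hP hc hM g hgc hL hB)

end Summit.QuantumFields.YangMills.Theorems.BalabanUVNodesN19LawSummabilityThresholdSharp

end
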